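import Literature.Analysis.FluidPDE.ElgindiKMomentEnergy
import Literature.Analysis.FluidPDE.ElgindiHkNonDensity
import HarnessLib

/-!
# `L₁₂(g)` as an element of `𝓗⁴` (Elgindi 2021, Proposition 8.20), and the `𝓗⁴` functional of a
general separable product ([Elgindi2021] §8.5 Proposition 8.20; §7.5)

Topic `Literature/Analysis/FluidPDE`. Proof file (everything proved, no definitions, no named
facts) on the proof path of the named fact
`Literature.Analysis.FluidPDE.Elgindi.ElgindiGhoulMasmoudi2021_stabilityCore`
(`ElgindiStabilityDecomposition.lean`). T. M. Elgindi, Ann. of Math. 194 (2021) =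
arXiv:1904.04795, §8.5 Proposition 8.20 (p. 28): "There exists a universal constant `C > 0` so
that for all `g ∈ 𝓗⁴` with `L₁₂(g)(0) = 0` we have that `L₁₂(g) ∈ 𝓗⁴` and
`|L₁₂(g)|_{𝓗⁴} ≤ C|g|_{𝓗⁴}`. Proof. … `L₁₂(g)` is independent of `θ` so all we only need to show
that `|D_z^kL₁₂(g)w|_{L²_z} ≤ C|g|_{𝓗⁴}` for `0 ≤ k ≤ 4`. Since `D_RL₁₂(g) = (g, K)_{L²_θ}`, the only
non-trivial case is `k = 0`", the case `k = 0` being the Hardy inequality of Lemma 5.4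
(`ElgindiHardyL12.lean`).

**What is proved** (at `k = 4`, for test functions `f` of the open strip):
* `eHkNormSq_tensor_le_of_angular`: for a separable product `g(R)a(θ)` with `g ∈ C⁴(0,∞)`,
  `a ∈ C⁴(0,π/2)`, `|g ⊗ a|²_{𝓗⁴} ≤ 30·C·Σ_{j≤4} A_j(g)` as soon as the angular energies
  `∫ a²s^{−η}`, `∫ (Dθ₁^ia)²s^{−γ}` (`1 ≤ i ≤ 4`) are `≤ C` (`A_j(g) = ∫_{R>0} w²(Dz₁^jg)²`, the
  `radialEnergy` of `ElgindiTensorHk.lean`; Tonelli on the strip) — the general form of the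
  `sin 2θ`-tensor bound of `ElgindiTensorHk.lean`;
* `sum_radialEnergy_L12_le`: `Σ_{j≤4} A_j(L₁₂f) ≤ 20|f|²_{𝓗⁴}` for a test function `f` with
  `L₁₂(f)(0) = 0` (`A₀` by Lemma 5.4, `hardyL12`; `A_{j+1}(L₁₂f) = A_j((f,K)_θ) ≤ (9π/32)|f|²` by
  `radialEnergy_kMoment_le`);
* `eHkNormSq_L12_le` (**Proposition 8.20 at `k = 4`**): `|L₁₂(f)|²_{𝓗⁴} ≤ 60000π·|f|²_{𝓗⁴}`, the
  function `(z, θ) ↦ L₁₂(f)(z)` on the strip (`∫₀^{π/2} sin(2θ)^{−η}dθ ≤ 100π`).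
-/

noncomputable section

open MeasureTheory Set Function Real Filter Finset
open _root_.Topology
open scoped ENNReal ContDiff

namespace Literature.Analysis.FluidPDE

namespace Elgindi

/-! ### Tonelli for the weighted words of a separable product -/

/-- `ofReal ∫ f ≤ ∫⁻ ofReal f` for a.e. nonnegative `f` (no integrability needed). [folklore] -/
private theorem ofReal_integral_le_lintegral_ofReal'' {X : Type*} [MeasurableSpace X] {μ : Measure X}
    {f : X → ℝ} (hf : 0 ≤ᵐ[μ] f) :
    ENNReal.ofReal (∫ x, f x ∂μ) ≤ ∫⁻ x, ENNReal.ofReal (f x) ∂μ := by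
  by_cases hfi : Integrable f μ
  · rw [ofReal_integral_eq_lintegral_ofReal hfi hf]
  · rw [integral_undef hfi, ENNReal.ofReal_zero]
    exact zero_le

/-- A.e.-measurability of `R ↦ ofReal(w²(Dz₁^jg)²)` on `(0,∞)` for `g ∈ C⁴(0,∞)`, `j ≤ 4`. [folklore] -/
theorem aemeasurable_radialEnergy_integrand {g : ℝ → ℝ} (hg : ContDiffOn ℝ 4 g (Ioi 0)) {j : ℕ} (hj : j ≤ 4) :
    AEMeasurable (fun R : ℝ => ENNReal.ofReal (radialWeight R ^ 2 * (Dz₁^[j] g) R ^ 2)) (volume.restrict (Ioi 0)) := by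
  have h1 : ContinuousOn (fun R : ℝ => radialWeight R ^ 2) (Ioi 0) := by
    unfold radialWeight
    exact ContinuousOn.pow (ContinuousOn.div (by fun_prop) (by fun_prop) fun R hR => pow_ne_zero 2 (ne_of_gt hR)) 2
  have h2 : ContinuousOn (Dz₁^[j] g) (Ioi 0) := (contDiffOn_iterate_Dz₁_Ioi (N := 4) hg (l := j) (m := 0) (by omega)).continuousOn
  exact ((h1.mul (h2.pow 2)).aemeasurable measurableSet_Ioi).ennreal_ofReal

/-- A.e.-measurability of `θ ↦ ofReal((Dθ₁^ia)²sin(2θ)^{−c})` on `(0,π/2)` for `a ∈ C⁴`, `i ≤ 4`. [folklore] -/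
theorem aemeasurable_angularEnergy_integrand {a : ℝ → ℝ} (ha : ContDiffOn ℝ 4 a (Ioo 0 (π / 2))) {i : ℕ} (hi : i ≤ 4) (c : ℝ) :
    AEMeasurable (fun θ : ℝ => ENNReal.ofReal ((Dθ₁^[i] a) θ ^ 2 * Real.sin (2 * θ) ^ (-c))) (volume.restrict (Ioo 0 (π / 2))) := by
  have h1 : ContinuousOn (Dθ₁^[i] a) (Ioo 0 (π / 2)) := (contDiffOn_iterate_Dθ₁_Ioo (N := 4) ha (l := i) (m := 0) (by omega)).continuousOn
  have h2 : ContinuousOn (fun θ : ℝ => Real.sin (2 * θ) ^ (-c)) (Ioo 0 (π / 2)) := by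
    intro θ hθ
    have hs : Real.sin (2 * θ) ≠ 0 := (Real.sin_pos_of_pos_of_lt_pi (by linarith [hθ.1]) (by linarith [hθ.2])).ne'
    exact ((Real.continuous_sin.comp (continuous_const.mul continuous_id)).continuousAt.rpow_const (Or.inl hs)).continuousWithinAt
  exact (((h1.pow 2).mul h2).aemeasurable measurableSet_Ioo).ennreal_ofReal

/-- **Tonelli for one weighted word of `g ⊗ a`**:
`∫∫_strip w²((Dz₁^jg)(R)(Dθ₁^ia)(θ))²s^{−c} = A_j(g)·∫₀^{π/2}(Dθ₁^ia)²s^{−c}`. [folklore] -/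
theorem lintegral_word_tensor_eq {g a : ℝ → ℝ} (hg : ContDiffOn ℝ 4 g (Ioi 0)) (ha : ContDiffOn ℝ 4 a (Ioo 0 (π / 2)))
    {i j : ℕ} (hi : i ≤ 4) (hj : j ≤ 4) (c : ℝ) :
    ∫⁻ p in strip, ENNReal.ofReal (radialWeight p.1 ^ 2 * ((Dz₁^[j] g) p.1 * (Dθ₁^[i] a) p.2) ^ 2 * Real.sin (2 * p.2) ^ (-c)) =
      radialEnergy j g * ∫⁻ θ in Ioo 0 (π / 2), ENNReal.ofReal ((Dθ₁^[i] a) θ ^ 2 * Real.sin (2 * θ) ^ (-c)) := by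
  have e : ∀ p ∈ strip, ENNReal.ofReal (radialWeight p.1 ^ 2 * ((Dz₁^[j] g) p.1 * (Dθ₁^[i] a) p.2) ^ 2 * Real.sin (2 * p.2) ^ (-c)) =
      (fun R => ENNReal.ofReal (radialWeight R ^ 2 * (Dz₁^[j] g) R ^ 2)) p.1 * (fun θ => ENNReal.ofReal ((Dθ₁^[i] a) θ ^ 2 * Real.sin (2 * θ) ^ (-c))) p.2 := by
    intro p hp
    have h0 : 0 ≤ radialWeight p.1 ^ 2 * (Dz₁^[j] g) p.1 ^ 2 := by positivity
    rw [← ENNReal.ofReal_mul h0]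
    congr 1; ring
  rw [setLIntegral_congr_fun measurableSet_strip e, lintegral_strip_tensor (aemeasurable_radialEnergy_integrand hg hj) (aemeasurable_angularEnergy_integrand ha hi c)]
  rfl

/-- **The `𝓗⁴` functional of a separable product**: for `g ∈ C⁴(0,∞)`, `a ∈ C⁴(0,π/2)` with
angular energies `∫₀^{π/2} a²sin(2θ)^{−η} ≤ C` and `∫₀^{π/2}(Dθ₁^ia)²sin(2θ)^{−γ} ≤ C` (`1 ≤ i ≤ 4`),
`|g ⊗ a|²_{𝓗⁴} ≤ 30·C·Σ_{j≤4} A_j(g)`. (The words separate, `D_θ^iD_R^j(g ⊗ a) = Dz₁^jg ⊗ Dθ₁^ia`,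
and Tonelli.) [cite: Elgindi2021, §7.5 (p. 24) and §8.5 Proposition 8.20 (p. 28 of arXiv:1904.04795): "`L₁₂(g)` is independent of `θ` so … `|D_z^kL₁₂(g)w|_{L²_z} ≤ C|g|_{𝓗⁴}`"] -/
theorem eHkNormSq_tensor_le_of_angular (α : ℝ) {g a : ℝ → ℝ} (hg : ContDiffOn ℝ 4 g (Ioi 0)) (ha : ContDiffOn ℝ 4 a (Ioo 0 (π / 2)))
    {C : ℝ≥0∞} (hC0 : ∫⁻ θ in Ioo 0 (π / 2), ENNReal.ofReal (a θ ^ 2 * Real.sin (2 * θ) ^ (-eta)) ≤ C)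
    (hC : ∀ i : ℕ, 1 ≤ i → i ≤ 4 → ∫⁻ θ in Ioo 0 (π / 2), ENNReal.ofReal ((Dθ₁^[i] a) θ ^ 2 * Real.sin (2 * θ) ^ (-gammaExp α)) ≤ C) :
    eHkNormSq α 4 (tensor g a) ≤ 30 * (C * ∑ j ∈ range 5, radialEnergy j g) := by
  have hA : ∀ j, j ≤ 4 → radialEnergy j g ≤ ∑ j ∈ range 5, radialEnergy j g := fun j hj =>
    single_le_sum (f := fun j => radialEnergy j g) (fun _ _ => bot_le) (mem_range.2 (by omega))
  have hB := eHkNormSq_le_of_forall_le (α := α) (k := 4) (f := tensor g a) (B := C * ∑ j ∈ range 5, radialEnergy j g)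
    (fun j hj => by
      rw [eL2Sq_eq_lintegral_ofReal]
      have e : ∀ p ∈ strip, ENNReal.ofReal ((hkRadialTerm j (tensor g a) p.1 p.2) ^ 2) =
          ENNReal.ofReal (radialWeight p.1 ^ 2 * ((Dz₁^[j] g) p.1 * (Dθ₁^[0] a) p.2) ^ 2 * Real.sin (2 * p.2) ^ (-eta)) := by
        intro p hp
        rw [sq_hkRadialTerm j _ hp, iterate_Dz_tensor]
        simp only [tensor_apply, Function.iterate_zero, id_eq]
      rw [setLIntegral_congr_fun measurableSet_strip e, lintegral_word_tensor_eq hg ha (by norm_num) hj, mul_comm]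
      exact mul_le_mul' (by simpa using hC0) (hA j hj))
    (fun i j hi hij => by
      rw [eL2Sq_eq_lintegral_ofReal]
      have e : ∀ p ∈ strip, ENNReal.ofReal ((hkMixedTerm α i j (tensor g a) p.1 p.2) ^ 2) =
          ENNReal.ofReal (radialWeight p.1 ^ 2 * ((Dz₁^[j] g) p.1 * (Dθ₁^[i] a) p.2) ^ 2 * Real.sin (2 * p.2) ^ (-gammaExp α)) := by
        intro p hp
        rw [sq_hkMixedTerm α i j _ hp, iterate_Dθ_Dz_tensor]
        simp only [tensor_apply]
      rw [setLIntegral_congr_fun measurableSet_strip e, lintegral_word_tensor_eq hg ha (by omega) (by omega), mul_comm]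
      exact mul_le_mul' (hC i hi (by omega)) (hA j (by omega)))
  refine hB.trans (le_of_eq ?_)
  norm_num

/-! ### The radial energies of `L₁₂(f)` -/

section L12

variable {f : ℝ → ℝ → ℝ} (hf : StripTest f)
include hf

/-- **`A₀(L₁₂f) ≤ 16·‖f·w/s^{η/2}‖²`** for a test function with `L₁₂(f)(0) = 0`: Lemma 5.4
(`hardyL12`) read in `ℝ≥0∞`, with `1 ≤ sin(2θ)^{−η}`. [cite: Elgindi2021, §5 Lemma 5.4 (p. 15) and §8.5 Proposition 8.20, case k = 0 (p. 28 of arXiv:1904.04795)] -/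
theorem radialEnergy_zero_L12_le (hL0 : L12 f 0 = 0) : radialEnergy 0 (L12 f) ≤ ENNReal.ofReal 16 * eL2Sq (hkRadialTerm 0 f) := by
  have hfc : Continuous (uncurry f) := (hf.smooth 0).continuous
  obtain ⟨a, b, ha, -, hfab⟩ := exists_radial_bounds' hf.supp hf.sub
  set L : ℝ → ℝ := L12 f with hLdef
  have hLc : Continuous L := continuous_L12 hfc hf.supp hf.sub
  have hLa : ∀ z, z < a → L z = 0 := fun z hz => (L12_eq_L12_zero_of_le hfc ha hfab hz.le).trans hL0
  have hLb : ∀ z, b < z → L z = 0 := fun z hz => L12_eq_zero_of_le hfc ha hfab hz.le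
  -- integrability of `w²L²` on `ℝ`
  have hwc : ContinuousOn (fun z : ℝ => radialWeight z ^ 2) {0}ᶜ := by
    unfold radialWeight
    exact ContinuousOn.pow (ContinuousOn.div (by fun_prop) (by fun_prop) fun z hz => pow_ne_zero 2 hz) 2
  have hcont : Continuous fun z => radialWeight z ^ 2 * L z ^ 2 :=
    continuous_mul_of_eq_zero_lt hwc (hLc.pow 2) ha fun z hz => by simp [hLa z hz]
  have hsupp : HasCompactSupport fun z => radialWeight z ^ 2 * L z ^ 2 := by
    refine HasCompactSupport.intro (isCompact_Icc (a := a) (b := b)) fun z hz => ?_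
    rcases not_and_or.1 (fun h => hz ⟨h.1, h.2⟩ : ¬(a ≤ z ∧ z ≤ b)) with h | h
    · simp [hLa z (not_le.1 h)]
    · simp [hLb z (not_le.1 h)]
  have hint : Integrable fun z => radialWeight z ^ 2 * L z ^ 2 := hcont.integrable_of_hasCompactSupport hsupp
  have hH := hardyL12 hfc hf.supp hf.sub hL0
  have eH : ∫ z, (L12 f z * radialWeight z) ^ 2 = ∫ z, radialWeight z ^ 2 * L z ^ 2 := integral_congr_ae (ae_of_all _ fun z => by ring)
  rw [eH] at hH
  calc radialEnergy 0 (L12 f) = ∫⁻ R in Ioi 0, ENNReal.ofReal (radialWeight R ^ 2 * L R ^ 2) := by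
        simp only [radialEnergy, Function.iterate_zero, id_eq, hLdef]
    _ ≤ ∫⁻ R, ENNReal.ofReal (radialWeight R ^ 2 * L R ^ 2) := setLIntegral_le_lintegral _ _
    _ = ENNReal.ofReal (∫ z, radialWeight z ^ 2 * L z ^ 2) := (ofReal_integral_eq_lintegral_ofReal hint (ae_of_all _ fun z => by positivity)).symm
    _ ≤ ENNReal.ofReal (16 * ∫ p in strip, (f p.1 p.2 * radialWeight p.1) ^ 2) := ENNReal.ofReal_le_ofReal hH
    _ = ENNReal.ofReal 16 * ENNReal.ofReal (∫ p in strip, (f p.1 p.2 * radialWeight p.1) ^ 2) := by rw [ENNReal.ofReal_mul (by norm_num)]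
    _ ≤ ENNReal.ofReal 16 * ∫⁻ p in strip, ENNReal.ofReal ((f p.1 p.2 * radialWeight p.1) ^ 2) :=
        mul_le_mul_right (ofReal_integral_le_lintegral_ofReal'' (ae_of_all _ fun p => sq_nonneg _)) _
    _ ≤ ENNReal.ofReal 16 * eL2Sq (hkRadialTerm 0 f) := by
        refine mul_le_mul_right ?_ _
        rw [eL2Sq_eq_lintegral_ofReal]
        refine setLIntegral_mono' measurableSet_strip fun p hp => ENNReal.ofReal_le_ofReal ?_
        rw [sq_hkRadialTerm 0 f hp]
        simp only [Function.iterate_zero, id_eq]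
        have h1 := one_le_sin_rpow_neg_eta hp
        have h0 : 0 ≤ radialWeight p.1 ^ 2 * f p.1 p.2 ^ 2 := by positivity
        calc (f p.1 p.2 * radialWeight p.1) ^ 2 = radialWeight p.1 ^ 2 * f p.1 p.2 ^ 2 * 1 := by ring
          _ ≤ radialWeight p.1 ^ 2 * f p.1 p.2 ^ 2 * Real.sin (2 * p.2) ^ (-eta) := mul_le_mul_of_nonneg_left h1 h0

/-- **`A_{j+1}(L₁₂f) = A_j((f,K)_θ) ≤ (9π/32)·‖D_R^jf·w/s^{η/2}‖²`**: every radial derivative of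
`L₁₂(f)` is a `K`-moment ("`D_RL₁₂(g) = (g, K)_{L²_θ}`, the only non-trivial case is `k = 0`"). [cite: Elgindi2021, §8.5 Proposition 8.20 (p. 28 of arXiv:1904.04795)] -/
theorem radialEnergy_succ_L12_le (j : ℕ) : radialEnergy (j + 1) (L12 f) ≤ ENNReal.ofReal (9 * π / 32) * eL2Sq (hkRadialTerm j f) := by
  have hj : ContDiff ℝ j (uncurry f) := hf.smooth j
  have e : ∀ R, (Dz₁^[j + 1] (L12 f)) R ^ 2 = (Dz₁^[j] (kMoment f)) R ^ 2 := by
    intro R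
    rw [iterate_Dz₁_L12 hj hf.supp hf.sub R, iterate_Dz₁_kMoment hj hf.supp R, neg_sq]
  calc radialEnergy (j + 1) (L12 f) = radialEnergy j (kMoment f) := by
        unfold radialEnergy; simp_rw [e]
    _ ≤ ENNReal.ofReal (9 * π / 32) * eL2Sq (hkRadialTerm j f) := radialEnergy_kMoment_le hj hf.supp

/-- **`Σ_{j≤4} A_j(L₁₂f) ≤ 20|f|²_{𝓗⁴}`** for a test function with `L₁₂(f)(0) = 0` (`16 + 4·9π/32 < 20`). [cite: Elgindi2021, §8.5 Proposition 8.20 (p. 28 of arXiv:1904.04795)] -/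
theorem sum_radialEnergy_L12_le (hL0 : L12 f 0 = 0) (α : ℝ) :
    ∑ j ∈ range 5, radialEnergy j (L12 f) ≤ 20 * eHkNormSq α 4 f := by
  rw [Finset.sum_range_succ']
  have h0 : radialEnergy 0 (L12 f) ≤ ENNReal.ofReal 16 * eHkNormSq α 4 f :=
    (radialEnergy_zero_L12_le hf hL0).trans (mul_le_mul_right (eL2Sq_hkRadialTerm_le α (by norm_num) f) _)
  have hS : ∑ j ∈ range 4, radialEnergy (j + 1) (L12 f) ≤ ∑ _j ∈ range 4, ENNReal.ofReal (9 * π / 32) * eHkNormSq α 4 f := by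
    refine sum_le_sum fun j hj => ?_
    have hj' : j ≤ 4 := by have := mem_range.1 hj; omega
    exact (radialEnergy_succ_L12_le hf j).trans (mul_le_mul_right (eL2Sq_hkRadialTerm_le α hj' f) _)
  rw [sum_const, card_range, nsmul_eq_mul] at hS
  have hπ : ENNReal.ofReal (9 * π / 32) ≤ 1 := by
    rw [← ENNReal.ofReal_one]; exact ENNReal.ofReal_le_ofReal (by nlinarith [Real.pi_lt_d2])
  have h16 : ENNReal.ofReal 16 = 16 := by norm_num
  calc ∑ j ∈ range 4, radialEnergy (j + 1) (L12 f) + radialEnergy 0 (L12 f)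
      ≤ (4 : ℝ≥0∞) * (ENNReal.ofReal (9 * π / 32) * eHkNormSq α 4 f) + ENNReal.ofReal 16 * eHkNormSq α 4 f := by
        refine add_le_add ?_ h0
        exact_mod_cast hS
    _ ≤ 4 * (1 * eHkNormSq α 4 f) + 16 * eHkNormSq α 4 f := by
        rw [h16]; gcongr
    _ = 20 * eHkNormSq α 4 f := by ring

/-! ### Proposition 8.20 -/

omit hf in
/-- The `η`-weighted angular energy of the constant `1`: `∫₀^{π/2} sin(2θ)^{−η} ≤ 100π` in `ℝ≥0∞`. [folklore] -/
theorem lintegral_rpow_neg_eta_le : ∫⁻ θ in Ioo 0 (π / 2), ENNReal.ofReal (Real.sin (2 * θ) ^ (-eta)) ≤ ENNReal.ofReal (100 * π) := by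
  have hr1 : -1 < -eta := by unfold eta; norm_num
  have hr0 : -eta ≤ 0 := by unfold eta; norm_num
  have hi := integrableOn_sin_two_mul_rpow hr1 hr0
  have hnn : 0 ≤ᵐ[volume.restrict (Ioo 0 (π / 2))] fun θ => Real.sin (2 * θ) ^ (-eta) :=
    (ae_restrict_iff' measurableSet_Ioo).2 (ae_of_all _ fun θ hθ =>
      Real.rpow_nonneg (Real.sin_pos_of_pos_of_lt_pi (by linarith [hθ.1]) (by linarith [hθ.2])).le _)
  rw [← ofReal_integral_eq_lintegral_ofReal hi hnn]
  refine ENNReal.ofReal_le_ofReal ((integral_sin_two_mul_rpow_le hr1 hr0).trans (le_of_eq ?_))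
  unfold eta; ring

/-- **Elgindi 2021, Proposition 8.20, at `k = 4` for test functions**: for a test function `f` of
the open strip with `L₁₂(f)(0) = 0`, the function `(z, θ) ↦ L₁₂(f)(z)` has
`|L₁₂(f)|²_{𝓗⁴} ≤ 60000π·|f|²_{𝓗⁴}` (any real `α`: only the `η`-weighted radial words are non-zero). [cite: Elgindi2021, §8.5 Proposition 8.20 (p. 28 of arXiv:1904.04795)] -/
theorem eHkNormSq_L12_le (hL0 : L12 f 0 = 0) (α : ℝ) :
    eHkNormSq α 4 (fun z _ => L12 f z) ≤ ENNReal.ofReal (60000 * π) * eHkNormSq α 4 f := by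
  have e : (fun z _ => L12 f z) = tensor (L12 f) (fun _ => (1:ℝ)) := by
    funext z θ; simp [tensor_apply]
  rw [e]
  have hg : ContDiffOn ℝ 4 (L12 f) (Ioi 0) := (contDiff_L12 (hf.smooth 4) hf.supp hf.sub).contDiffOn
  have ha : ContDiffOn ℝ 4 (fun _ : ℝ => (1:ℝ)) (Ioo 0 (π / 2)) := contDiffOn_const
  have hC0 : ∫⁻ θ in Ioo 0 (π / 2), ENNReal.ofReal ((fun _ : ℝ => (1:ℝ)) θ ^ 2 * Real.sin (2 * θ) ^ (-eta)) ≤ ENNReal.ofReal (100 * π) := by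
    simpa using lintegral_rpow_neg_eta_le
  have hC : ∀ i : ℕ, 1 ≤ i → i ≤ 4 → ∫⁻ θ in Ioo 0 (π / 2), ENNReal.ofReal ((Dθ₁^[i] (fun _ : ℝ => (1:ℝ))) θ ^ 2 * Real.sin (2 * θ) ^ (-gammaExp α)) ≤ ENNReal.ofReal (100 * π) := by
    intro i hi _
    obtain ⟨i, rfl⟩ : ∃ i', i = i' + 1 := ⟨i - 1, by omega⟩
    rw [iterate_Dθ₁_constFun_succ]
    simp
  have h := eHkNormSq_tensor_le_of_angular α hg ha hC0 hC
  have hS := sum_radialEnergy_L12_le hf hL0 α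
  have e6 : ENNReal.ofReal (60000 * π) = 600 * ENNReal.ofReal (100 * π) := by
    rw [show (60000 : ℝ) * π = 600 * (100 * π) by ring, ENNReal.ofReal_mul (by norm_num)]
    norm_num
  calc eHkNormSq α 4 (tensor (L12 f) fun _ => 1) ≤ 30 * (ENNReal.ofReal (100 * π) * ∑ j ∈ range 5, radialEnergy j (L12 f)) := h
    _ ≤ 30 * (ENNReal.ofReal (100 * π) * (20 * eHkNormSq α 4 f)) := by gcongr
    _ = ENNReal.ofReal (60000 * π) * eHkNormSq α 4 f := by rw [e6]; ring

end L12

end Elgindi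

end Literature.Analysis.FluidPDE
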